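import Literature.Combinatorics.Optimization.LovaszSchrijverMatchingRank
import HarnessLib

/-!
# Finite convergence of the Lovász–Schrijver operators: `Nᵈ(K) = Nᵈ₊(K) = K_I` (PROVED)

The second half of **Theorem 3.1** of T. Stephen, L. Tunçel, *On a representation of the matching
polytope via semidefinite liftings*, Math. Oper. Res. **24** (1999) 1–7 [StephenTuncel1999], p. 3
("Lovász–Schrijver (1991)"):

> `K ⊇ N(K) ⊇ N²(K) ⊇ ⋯ ⊇ Nᵈ(K) = K_I` and `K ⊇ N₊(K) ⊇ N²₊(K) ⊇ ⋯ ⊇ Nᵈ₊(K) = K_I`,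

for a cone `K ⊆ Q ⊆ ℝ^{d+1}`, `K_I` the cone generated by the 0-1 vectors of `K` — the finite
convergence theorem of L. Lovász, A. Schrijver, *Cones of matrices and set-functions and 0-1
optimization*, SIAM J. Optim. 1 (1991) 166–190 [LovaszSchrijver1991] (also M. Laurent, Math.
Oper. Res. 28 (2003), §2, PDF p. 3: "Lovász and Schrijver (1991) show that `Nⁿ(K) = P`"
[Laurent2003]). The chain and `K_I ⊆ Nʳ₊(K)` are in `LovaszSchrijverMatchingRank.lean`; this
file PROVES the equality after `d = |ι|` rounds, in the cone form used there
(`LovaszSchrijver.N`, `Nplus`, `integralCone`, pointed cones `K ⊆ Q`).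

Proof (the standard one, Lovász–Schrijver 1991 §1 / Laurent 2003 §2): one round splits along any
coordinate `i` — if `x = Y e₀` with `Y ∈ M(L)` then `x = Y eᵢ + Y(e₀ − eᵢ)` with
`Y eᵢ ∈ L ∩ {xᵢ = x₀}` and `Y(e₀ − eᵢ) ∈ L ∩ {xᵢ = 0}` (`N_subset_split`); hence after `|T|`
rounds every point is a sum of points of `K` lying on the faces `{xᵢ = aᵢ x₀, i ∈ T}`,
`a ∈ {0,1}^T` (`iterate_N_subset_faceSum`, using `0 ≤ xᵢ ≤ x₀` on `K` to push the face
conditions through sums), and for `T` = all coordinates these faces are the rays of the 0-1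
vectors of `K` (`faceSum_univ_subset_integralCone`). Main statements:
`iterate_N_card_eq_integralCone`, `iterate_Nplus_card_eq_integralCone`
(`N^{|ι|}(K) = N^{|ι|}₊(K) = K_I` for a pointed cone `K ⊆ Q`, `ι` nonempty), and the same for
every `r ≥ |ι|`.
-/

noncomputable section

open Matrix Finset

namespace Literature.Combinatorics.Optimization

namespace LovaszSchrijver

variable {ι : Type*}

/-- `Nʳ₊(K) ⊆ Nʳ(K)`. [cite: StephenTuncel1999, Thm. 3.1 (p. 3)] -/
theorem iterate_Nplus_subset_iterate_N (K : Set (Option ι → ℝ)) (r : ℕ) :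
    Nplus^[r] K ⊆ N^[r] K := by
  induction r with
  | zero => exact le_rfl
  | succ r ih =>
    rw [Function.iterate_succ_apply', Function.iterate_succ_apply']
    exact (Nplus_subset_N _).trans (N_mono ih)

/-- `Nʳ` is monotone in `K` (immediate from the definition). [cite: StephenTuncel1999, §3 (p. 2)] -/
theorem iterate_N_mono {K K' : Set (Option ι → ℝ)} (h : K ⊆ K') (r : ℕ) :
    N^[r] K ⊆ N^[r] K' := by
  induction r with
  | zero => exact h
  | succ r ih =>
    rw [Function.iterate_succ_apply', Function.iterate_succ_apply']
    exact N_mono ih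

/-- `N^{r+1}(K) ⊆ Nʳ(K)`. [cite: StephenTuncel1999, Thm. 3.1 (p. 3)] -/
theorem iterate_N_succ_subset (K : Set (Option ι → ℝ)) (r : ℕ) : N^[r + 1] K ⊆ N^[r] K := by
  rw [Function.iterate_succ_apply']
  exact N_subset _

/-- The chain `K ⊇ N(K) ⊇ N²(K) ⊇ ⋯`. [cite: StephenTuncel1999, Thm. 3.1 (p. 3)] -/
theorem iterate_N_antitone (K : Set (Option ι → ℝ)) {r s : ℕ} (h : r ≤ s) :
    N^[s] K ⊆ N^[r] K := by
  induction h with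
  | refl => exact le_rfl
  | step _ ih => exact (iterate_N_succ_subset K _).trans ih

/-- `K_I ⊆ Nʳ(K)` for a pointed cone `K ⊆ Q`. [cite: StephenTuncel1999, Thm. 3.1 (p. 3)] -/
theorem integralCone_subset_iterate_N [Fintype ι] (C : PointedCone ℝ (Option ι → ℝ))
    (hCQ : (C : Set (Option ι → ℝ)) ⊆ coneQ ι) (r : ℕ) :
    integralCone (C : Set (Option ι → ℝ)) ⊆ N^[r] (C : Set (Option ι → ℝ)) :=
  (integralCone_subset_iterate_Nplus C hCQ r).trans (iterate_Nplus_subset_iterate_N _ r)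

/-- **One round splits along a coordinate** (Lovász–Schrijver's Lemma 1.3 in cone form): if
`x ∈ N(L)` then `x = y + z` with `y ∈ L`, `yᵢ = y₀` and `z ∈ L`, `zᵢ = 0` — namely `y = Y eᵢ`,
`z = Y(e₀ − eᵢ)`. [cite: Laurent2003, §2 (PDF p. 3)] [cite: StephenTuncel1999, Def. 3.1 (iii*) (p. 3)] -/
theorem N_subset_split (L : Set (Option ι → ℝ)) (i : ι) {x : Option ι → ℝ} (hx : x ∈ N L) :
    ∃ y ∈ L, ∃ z ∈ L, y (some i) = y none ∧ z (some i) = 0 ∧ x = y + z := by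
  obtain ⟨Y, hY, rfl⟩ := hx
  refine ⟨Y (some i), hY.row_mem (some i), Y none - Y (some i), hY.sub_mem i, ?_, ?_, ?_⟩
  · rw [hY.diag_eq i, hY.symm.apply (some i) none]
  · simp [hY.diag_eq i]
  · simp

/-- The face cone `K ∩ {xᵢ = aᵢ x₀ : i ∈ T}` of a 0-1 pattern `a` on the coordinates `T`.
[cite: Laurent2003, §2 (PDF p. 3: `P = conv(K ∩ {0,1}ⁿ)` via the faces)] -/
def faceCone (K : Set (Option ι → ℝ)) (T : Finset ι) (a : ι → Bool) : Set (Option ι → ℝ) :=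
  {x | x ∈ K ∧ ∀ i ∈ T, x (some i) = if a i then x none else 0}

/-- Finite sums of points of the face cones over all patterns (a pattern only matters on `T`).
[cite: Laurent2003, §2 (PDF p. 3)] -/
def faceSum [Fintype ι] [DecidableEq ι] (K : Set (Option ι → ℝ)) (T : Finset ι) :
    Set (Option ι → ℝ) :=
  {x | ∃ f : (ι → Bool) → Option ι → ℝ, (∀ a, f a ∈ faceCone K T a) ∧ x = ∑ a, f a}

/-- Face cones of a pointed cone are closed under sums. [cite: Laurent2003, §2 (PDF p. 3)] -/
theorem faceCone_add (C : PointedCone ℝ (Option ι → ℝ)) (T : Finset ι) (a : ι → Bool)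
    {x y : Option ι → ℝ} (hx : x ∈ faceCone (C : Set (Option ι → ℝ)) T a)
    (hy : y ∈ faceCone (C : Set (Option ι → ℝ)) T a) :
    x + y ∈ faceCone (C : Set (Option ι → ℝ)) T a := by
  refine ⟨C.add_mem hx.1 hy.1, fun i hi => ?_⟩
  simp only [Pi.add_apply, hx.2 i hi, hy.2 i hi]
  split_ifs <;> simp

/-- Face cones of a pointed cone contain `0`. [cite: Laurent2003, §2 (PDF p. 3)] -/
theorem zero_mem_faceCone (C : PointedCone ℝ (Option ι → ℝ)) (T : Finset ι) (a : ι → Bool) :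
    (0 : Option ι → ℝ) ∈ faceCone (C : Set (Option ι → ℝ)) T a :=
  ⟨C.zero_mem, fun i _ => by simp⟩

/-- Face cones of a pointed cone are closed under finite sums. [cite: Laurent2003, §2 (PDF p. 3)] -/
theorem sum_mem_faceCone {β : Type*} (C : PointedCone ℝ (Option ι → ℝ)) (T : Finset ι)
    (a : ι → Bool) (s : Finset β) (f : β → Option ι → ℝ)
    (hf : ∀ b ∈ s, f b ∈ faceCone (C : Set (Option ι → ℝ)) T a) :
    ∑ b ∈ s, f b ∈ faceCone (C : Set (Option ι → ℝ)) T a := by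
  classical
  induction s using Finset.induction_on with
  | empty => simpa using zero_mem_faceCone C T a
  | insert b s hb ih =>
    rw [sum_insert hb]
    exact faceCone_add C T a (hf b (mem_insert_self _ _))
      (ih fun b' hb' => hf b' (mem_insert_of_mem hb'))

/-- `K ⊆` the face sum over no constraints. [cite: Laurent2003, §2 (PDF p. 3)] -/
theorem subset_faceSum_empty [Fintype ι] [DecidableEq ι] (C : PointedCone ℝ (Option ι → ℝ)) :
    (C : Set (Option ι → ℝ)) ⊆ faceSum (C : Set (Option ι → ℝ)) ∅ := by
  classical
  intro x hx
  refine ⟨fun a => if a = fun _ => false then x else 0, fun a => ?_, ?_⟩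
  · by_cases ha : a = fun _ => false
    · simp only [ha, if_true]; exact ⟨hx, fun i hi => by simp at hi⟩
    · simp only [ha, if_false]; exact zero_mem_faceCone C ∅ a
  · rw [Finset.sum_ite_eq' univ (fun _ : ι => false) (fun _ => x), if_pos (mem_univ _)]

/-- **The inductive step**: `N` of the `T`-face sum lies in the `(insert i T)`-face sum, for a
pointed cone `K ⊆ Q` (the summands satisfy `0 ≤ xᵢ ≤ x₀`, so the face conditions `xᵢ = x₀`,
`xᵢ = 0` of the split pass to every summand). [cite: Laurent2003, §2 (PDF p. 3)] [cite: StephenTuncel1999, Thm. 3.1 (p. 3)] -/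
theorem N_faceSum_subset [Fintype ι] [DecidableEq ι] (C : PointedCone ℝ (Option ι → ℝ))
    (hCQ : (C : Set (Option ι → ℝ)) ⊆ coneQ ι) (T : Finset ι) (i : ι) :
    N (faceSum (C : Set (Option ι → ℝ)) T) ⊆ faceSum (C : Set (Option ι → ℝ)) (insert i T) := by
  intro x hx
  obtain ⟨y, ⟨f, hf, rfl⟩, z, ⟨g, hg, rfl⟩, hyi, hzi, rfl⟩ := N_subset_split _ i hx
  -- every summand of `y` has `xᵢ = x₀`, every summand of `z` has `xᵢ = 0`
  have hfi : ∀ a, f a (some i) = f a none := by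
    have hle : ∀ a ∈ (univ : Finset (ι → Bool)), f a (some i) ≤ f a none :=
      fun a _ => ((hCQ (hf a).1) i).2
    have heq : ∑ a, f a (some i) = ∑ a, f a none := by
      simpa [Finset.sum_apply] using hyi
    exact fun a => (Finset.sum_eq_sum_iff_of_le hle).mp heq a (mem_univ a)
  have hgi : ∀ a, g a (some i) = 0 := by
    have hle : ∀ a ∈ (univ : Finset (ι → Bool)), 0 ≤ g a (some i) :=
      fun a _ => ((hCQ (hg a).1) i).1
    have heq : ∑ a, g a (some i) = 0 := by
      simpa [Finset.sum_apply] using hzi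
    exact fun a => (Finset.sum_eq_zero_iff_of_nonneg hle).mp heq a (mem_univ a)
  -- regroup the summands by their pattern extended at `i`
  refine ⟨fun a => (∑ b ∈ univ.filter (fun b => Function.update b i true = a), f b) +
      ∑ b ∈ univ.filter (fun b => Function.update b i false = a), g b, fun a => ?_, ?_⟩
  · refine faceCone_add C _ a ?_ ?_
    · refine sum_mem_faceCone C _ a _ f fun b hb => ?_
      have hba : Function.update b i true = a := (mem_filter.mp hb).2
      refine ⟨(hf b).1, fun j hj => ?_⟩
      rcases Finset.mem_insert.mp hj with rfl | hjT
      · rw [hfi b, ← hba]; simp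
      · by_cases hji : j = i
        · subst hji; rw [hfi b, ← hba]; simp
        · rw [(hf b).2 j hjT, ← hba, Function.update_of_ne hji]
    · refine sum_mem_faceCone C _ a _ g fun b hb => ?_
      have hba : Function.update b i false = a := (mem_filter.mp hb).2
      refine ⟨(hg b).1, fun j hj => ?_⟩
      rcases Finset.mem_insert.mp hj with rfl | hjT
      · rw [hgi b, ← hba]; simp
      · by_cases hji : j = i
        · subst hji; rw [hgi b, ← hba]; simp
        · rw [(hg b).2 j hjT, ← hba, Function.update_of_ne hji]
  · rw [Finset.sum_add_distrib, Finset.sum_fiberwise univ (fun b => Function.update b i true) f,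
      Finset.sum_fiberwise univ (fun b => Function.update b i false) g]

/-- **After `|T|` rounds every point of `N^{|T|}(K)` is a sum of points of `K` on the faces
`{xᵢ = aᵢ x₀ : i ∈ T}`**, for a pointed cone `K ⊆ Q`. [cite: Laurent2003, §2 (PDF p. 3)] [cite: StephenTuncel1999, Thm. 3.1 (p. 3)] -/
theorem iterate_N_subset_faceSum [Fintype ι] [DecidableEq ι] (C : PointedCone ℝ (Option ι → ℝ))
    (hCQ : (C : Set (Option ι → ℝ)) ⊆ coneQ ι) (T : Finset ι) :
    N^[T.card] (C : Set (Option ι → ℝ)) ⊆ faceSum (C : Set (Option ι → ℝ)) T := by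
  induction T using Finset.induction_on with
  | empty => simpa using subset_faceSum_empty C
  | insert i T hi ih =>
    rw [Finset.card_insert_of_notMem hi, Function.iterate_succ_apply']
    exact (N_mono ih).trans (N_faceSum_subset C hCQ T i)

/-- **The faces over all coordinates are the rays of the 0-1 vectors**: the full face sum lies in
`K_I` (for `K ⊆ Q` a pointed cone, `ι` nonempty so that `x₀ ≥ 0` on `K`).
[cite: Laurent2003, §2 (PDF p. 3)] [cite: StephenTuncel1999, Thm. 3.1 (p. 3)] -/
theorem faceSum_univ_subset_integralCone [Fintype ι] [DecidableEq ι] [Nonempty ι]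
    (C : PointedCone ℝ (Option ι → ℝ))
    (hCQ : (C : Set (Option ι → ℝ)) ⊆ coneQ ι) :
    faceSum (C : Set (Option ι → ℝ)) univ ⊆ integralCone (C : Set (Option ι → ℝ)) := by
  classical
  rintro x ⟨f, hf, rfl⟩
  have hmem : ∀ a, f a ∈ integralCone (C : Set (Option ι → ℝ)) := by
    intro a
    obtain ⟨hK, hface⟩ := hf a
    set t := f a none with ht
    have ht0 : 0 ≤ t := by
      obtain ⟨j⟩ := ‹Nonempty ι›
      exact ((hCQ hK) j).1.trans ((hCQ hK) j).2
    -- the 0-1 vector `(1, a)`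
    set v : Option ι → ℝ := fun o => o.elim 1 fun j => if a j then 1 else 0 with hv
    have hfav : f a = t • v := by
      ext o
      cases o with
      | none => simp [v, ht]
      | some j => rw [hface j (mem_univ j)]; by_cases h : a j <;> simp [v, h, ht]
    rcases ht0.eq_or_lt with h0 | hpos
    · -- `t = 0`: the summand is `0`
      rw [hfav, ← h0, zero_smul]
      exact (PointedCone.hull ℝ {w | w ∈ (C : Set (Option ι → ℝ)) ∧ IsZeroOne w}).zero_mem
    · -- `t > 0`: `v = t⁻¹ • f a ∈ K` is a 0-1 vector of `K`
      have hvK : v ∈ (C : Set (Option ι → ℝ)) := by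
        have h := C.smul_mem (inv_nonneg.mpr hpos.le) hK
        rw [hfav, smul_smul, inv_mul_cancel₀ hpos.ne', one_smul] at h
        exact h
      have hv01 : IsZeroOne v := by
        intro o
        cases o with
        | none => right; simp [v]
        | some j => by_cases h : a j <;> simp [v, h]
      rw [hfav]
      exact (PointedCone.hull ℝ {w | w ∈ (C : Set (Option ι → ℝ)) ∧ IsZeroOne w}).smul_mem
        hpos.le (PointedCone.subset_hull ⟨hvK, hv01⟩)
  exact (PointedCone.hull ℝ {w | w ∈ (C : Set (Option ι → ℝ)) ∧ IsZeroOne w}).sum_mem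
    fun a _ => hmem a

/-- **Lovász–Schrijver finite convergence, `N` version: `N^{|ι|}(K) = K_I`** for a pointed cone
`K ⊆ Q` over a nonempty finite coordinate set `ι` (`d = |ι|`).
[cite: StephenTuncel1999, Thm. 3.1 (p. 3)] [cite: Laurent2003, §2 (PDF p. 3)] -/
theorem iterate_N_card_eq_integralCone [Fintype ι] [DecidableEq ι] [Nonempty ι]
    (C : PointedCone ℝ (Option ι → ℝ)) (hCQ : (C : Set (Option ι → ℝ)) ⊆ coneQ ι) :
    N^[Fintype.card ι] (C : Set (Option ι → ℝ)) = integralCone (C : Set (Option ι → ℝ)) := by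
  refine Set.Subset.antisymm ?_ (integralCone_subset_iterate_N C hCQ _)
  rw [← Finset.card_univ]
  exact (iterate_N_subset_faceSum C hCQ univ).trans (faceSum_univ_subset_integralCone C hCQ)

/-- **Lovász–Schrijver finite convergence, `N₊` version: `N^{|ι|}₊(K) = K_I`**.
[cite: StephenTuncel1999, Thm. 3.1 (p. 3)] [cite: Laurent2003, §2 (PDF p. 4)] -/
theorem iterate_Nplus_card_eq_integralCone [Fintype ι] [DecidableEq ι] [Nonempty ι]
    (C : PointedCone ℝ (Option ι → ℝ)) (hCQ : (C : Set (Option ι → ℝ)) ⊆ coneQ ι) :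
    Nplus^[Fintype.card ι] (C : Set (Option ι → ℝ)) = integralCone (C : Set (Option ι → ℝ)) := by
  refine Set.Subset.antisymm ?_ (integralCone_subset_iterate_Nplus C hCQ _)
  exact (iterate_Nplus_subset_iterate_N _ _).trans (iterate_N_card_eq_integralCone C hCQ).le

/-- `Nʳ(K) = K_I` for every `r ≥ |ι|`. [cite: StephenTuncel1999, Thm. 3.1 (p. 3)] -/
theorem iterate_N_eq_integralCone_of_le [Fintype ι] [DecidableEq ι] [Nonempty ι]
    (C : PointedCone ℝ (Option ι → ℝ)) (hCQ : (C : Set (Option ι → ℝ)) ⊆ coneQ ι) {r : ℕ}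
    (hr : Fintype.card ι ≤ r) :
    N^[r] (C : Set (Option ι → ℝ)) = integralCone (C : Set (Option ι → ℝ)) := by
  refine Set.Subset.antisymm ?_ (integralCone_subset_iterate_N C hCQ r)
  exact (iterate_N_antitone _ hr).trans (iterate_N_card_eq_integralCone C hCQ).le

/-- `Nʳ₊(K) = K_I` for every `r ≥ |ι|`. [cite: StephenTuncel1999, Thm. 3.1 (p. 3)] -/
theorem iterate_Nplus_eq_integralCone_of_le [Fintype ι] [DecidableEq ι] [Nonempty ι]
    (C : PointedCone ℝ (Option ι → ℝ)) (hCQ : (C : Set (Option ι → ℝ)) ⊆ coneQ ι) {r : ℕ}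
    (hr : Fintype.card ι ≤ r) :
    Nplus^[r] (C : Set (Option ι → ℝ)) = integralCone (C : Set (Option ι → ℝ)) := by
  refine Set.Subset.antisymm ?_ (integralCone_subset_iterate_Nplus C hCQ r)
  exact (iterate_Nplus_antitone _ hr).trans (iterate_Nplus_card_eq_integralCone C hCQ).le

end LovaszSchrijver

namespace StephenTuncel1999

open LovaszSchrijver

/-- **Theorem 3.1 for the matching cones**: `Nʳ₊(P(G)) = Nʳ(P(G)) = P_I(G)` for every
`r ≥ |E(G)|` (graphs with at least one edge). [cite: StephenTuncel1999, Thm. 3.1 (p. 3)] -/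
theorem iterate_Nplus_fracMatchingCone_eq {V : Type*} [Fintype V] [DecidableEq V]
    (G : SimpleGraph V) [DecidableRel G.Adj] [Nonempty G.edgeSet] {r : ℕ}
    (hr : Fintype.card G.edgeSet ≤ r) :
    Nplus^[r] (fracMatchingCone G) = matchingCone G :=
  iterate_Nplus_eq_integralCone_of_le (fracMatchingPointedCone G) (fracMatchingCone_subset_coneQ G) hr

end StephenTuncel1999

end Literature.Combinatorics.Optimization
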